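import Mathlib
import Summits.Ventures.HodgeRepro.Tier4.Common.RowPlane
import Summits.Ventures.HodgeRepro.Tier4.Common.RowTorus
import Summits.Ventures.HodgeRepro.Tier4.Common.MixedPlaneKType

/-!
# Tier4/Line4/TorusComm — the two adelic tori of a row plane are ABELIAN (the structural binder `hcomm` of the
kernel-level W3 discharged on the wall's instance)

Blind re-derivation cell `pub-hodge-repro`, Tier 4 «prove the step» (README §9–§10), seat t4-L4-p1 (gen 2).  Tree path
`lean/Summits/Ventures/HodgeRepro/Tier4/Line4/TorusComm.lean`.  Imports typer-2's `Common/RowPlane.lean`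
(`PlaneData.ofLinesRow`, `omegaMatR`, `commute_omegaMatR_iff`), `Common/RowTorus.lean` (`blockDiag4R`,
`exists_blockDiag4R_of_commute`, `adMat_blockDiag4`, `adMat_blockDiag4_one_zero`) and `Common/MixedPlaneKType.lean`
(`PlaneData.withTransportedTorus`).

THE ARGUMENT.  An element `x` of `T′ = g (U(W₁) × U(W₃⁻)) g⁻¹` of the transported plane commutes with the
transported projector `g P₀ g′` and (as every element of the unitary group) with `Ω`; so `C := g′ x g` commutes
with `P₀ = blockDiag4 1 0` — hence is block-diagonal (`exists_blockDiag4R_of_commute`) — and with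
`Ω = blockDiag4 ω ω` — hence each block commutes with `ω`, i.e. is `p • 1 + r • ω` (`commute_omegaMatR_iff`).  Two
such blocks commute (they live in the commutative subring `𝔸_k[ω]` of `M₂(𝔸_k)`), so `g′ x g` and `g′ y g`
commute, so `x y = y x`.  The untransported torus `T` is the same argument with `g = 1`.

WHAT IS PROVED.  `mul_comm_of_commute_omegaMatR` (two `2 × 2` matrices commuting with `ω` commute, any commutative
ring); the conjugation algebra over any ring (`inv_commute_of_commute`, `conj_commute_of_commute_conj`,
`conj_commute_of_commute`, `mul_comm_of_conj_mul_comm`); for ANY plane whose adelic `P₀` and `Ω` have the row shapes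
`blockDiag4R 1 0`, `blockDiag4R ω ω`: **`mul_comm_of_mem_torusT'_of_shapes`**, **`mul_comm_of_mem_torusT_of_shapes`**;
at the row plane: **`torusT'_mul_comm`**: `∀ s t : torusT' ((ofLinesRow q a b ε).withTransportedTorus g g' …),
s * t = t * s` — exactly the `hcomm` binder of `Line4/ThetaEquivariance.lean`'s `_of_isHaar` theorems at the seesaw
plane `seesawPlane q a g g' … = (mixedRow q (a 0) (a 2)).withTransportedTorus g g' …` of the wall — and
**`torusT_mul_comm`** for `torusT` of the row plane.  No hypothesis beyond the plane's data (`a, b, ε` may be `0`).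

HC_CM is NOT proved by anyone in this repository.
-/

set_option autoImplicit false

noncomputable section

namespace Summit.Ventures.HodgeRepro.Tier4.Line4

open Summit.Ventures.HodgeRepro.Tier4.Common Matrix NumberField

section Blocks

variable {R : Type} [CommRing R]

/-- **Two `2 × 2` matrices commuting with `ω` commute with each other** (both are `p • 1 + r • ω`). -/
theorem mul_comm_of_commute_omegaMatR (t n : R) {M N : Matrix (Fin 2) (Fin 2) R}
    (hM : M * omegaMatR t n = omegaMatR t n * M) (hN : N * omegaMatR t n = omegaMatR t n * N) : M * N = N * M := by
  obtain ⟨x, y, hM'⟩ : ∃ x y : R, M = x • (1 : Matrix (Fin 2) (Fin 2) R) + y • omegaMatR t n :=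
    ⟨M 0 0, M 1 0, (commute_omegaMatR_iff t n M).1 hM⟩
  obtain ⟨x', y', hN'⟩ : ∃ x y : R, N = x • (1 : Matrix (Fin 2) (Fin 2) R) + y • omegaMatR t n :=
    ⟨N 0 0, N 1 0, (commute_omegaMatR_iff t n N).1 hN⟩
  subst hM' hN'
  ext i j
  fin_cases i <;> fin_cases j <;> simp [omegaMatR, Matrix.mul_apply, Fin.sum_univ_two] <;> ring

/-- **Block-diagonal matrices whose blocks commute with `ω` commute with each other.** -/
theorem blockDiag4R_mul_comm_of_commute_omegaMatR (t n : R) {A D A' D' : Matrix (Fin 2) (Fin 2) R}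
    (hA : A * omegaMatR t n = omegaMatR t n * A) (hD : D * omegaMatR t n = omegaMatR t n * D)
    (hA' : A' * omegaMatR t n = omegaMatR t n * A') (hD' : D' * omegaMatR t n = omegaMatR t n * D') :
    blockDiag4R A D * blockDiag4R A' D' = blockDiag4R A' D' * blockDiag4R A D := by
  rw [blockDiag4R_mul, blockDiag4R_mul, mul_comm_of_commute_omegaMatR t n hA hA',
    mul_comm_of_commute_omegaMatR t n hD hD']

/-- A `4 × 4` matrix commuting with `blockDiag4R 1 0` and with `blockDiag4R ω ω` is block-diagonal with blocks
commuting with `ω`. -/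
theorem exists_blocks_of_commute (t n : R) (M : Matrix (Fin 4) (Fin 4) R)
    (hP : M * blockDiag4R 1 0 = blockDiag4R 1 0 * M)
    (hΩ : M * blockDiag4R (omegaMatR t n) (omegaMatR t n) = blockDiag4R (omegaMatR t n) (omegaMatR t n) * M) :
    ∃ A D : Matrix (Fin 2) (Fin 2) R, M = blockDiag4R A D ∧
      A * omegaMatR t n = omegaMatR t n * A ∧ D * omegaMatR t n = omegaMatR t n * D := by
  obtain ⟨A, D, hAD⟩ := exists_blockDiag4R_of_commute M hP
  rw [hAD, blockDiag4R_mul, blockDiag4R_mul] at hΩ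
  obtain ⟨hA, hD⟩ := blockDiag4R_inj.1 hΩ
  exact ⟨A, D, hAD, hA, hD⟩

/-- **Two `4 × 4` matrices commuting with `blockDiag4R 1 0` and `blockDiag4R ω ω` commute with each other.** -/
theorem mul_comm_of_commute_shapes (t n : R) {M N : Matrix (Fin 4) (Fin 4) R}
    (hMP : M * blockDiag4R 1 0 = blockDiag4R 1 0 * M)
    (hMΩ : M * blockDiag4R (omegaMatR t n) (omegaMatR t n) = blockDiag4R (omegaMatR t n) (omegaMatR t n) * M)
    (hNP : N * blockDiag4R 1 0 = blockDiag4R 1 0 * N)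
    (hNΩ : N * blockDiag4R (omegaMatR t n) (omegaMatR t n) = blockDiag4R (omegaMatR t n) (omegaMatR t n) * N) :
    M * N = N * M := by
  obtain ⟨A, D, hM, hA, hD⟩ := exists_blocks_of_commute t n M hMP hMΩ
  obtain ⟨A', D', hN, hA', hD'⟩ := exists_blocks_of_commute t n N hNP hNΩ
  rw [hM, hN]
  exact blockDiag4R_mul_comm_of_commute_omegaMatR t n hA hD hA' hD'

end Blocks

section ConjugationAlgebra

variable {S : Type} [Ring S]

/-- If `g` commutes with `Ω` and `g′` is its inverse, then `g′` commutes with `Ω`. -/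
theorem inv_commute_of_commute {G G' Ω : S} (hGG' : G * G' = 1) (hG'G : G' * G = 1) (hGΩ : G * Ω = Ω * G) :
    G' * Ω = Ω * G' := by
  calc G' * Ω = G' * Ω * (G * G') := by rw [hGG', mul_one]
    _ = G' * (Ω * G) * G' := by simp only [mul_assoc]
    _ = G' * (G * Ω) * G' := by rw [hGΩ]
    _ = Ω * G' := by rw [← mul_assoc, hG'G, one_mul]

/-- If `M` commutes with `G P G′`, then `G′ M G` commutes with `P`. -/
theorem conj_commute_of_commute_conj {G G' M P : S} (hG'G : G' * G = 1)
    (h : M * (G * P * G') = (G * P * G') * M) : (G' * M * G) * P = P * (G' * M * G) := by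
  calc G' * M * G * P = G' * M * G * P * (G' * G) := by rw [hG'G, mul_one]
    _ = G' * (M * (G * P * G')) * G := by simp only [mul_assoc]
    _ = G' * ((G * P * G') * M) * G := by rw [h]
    _ = (G' * G) * P * (G' * M * G) := by simp only [mul_assoc]
    _ = P * (G' * M * G) := by rw [hG'G, one_mul]

/-- If `M`, `G`, `G′` commute with `Ω`, so does `G′ M G`. -/
theorem conj_commute_of_commute {G G' M Ω : S} (hMΩ : M * Ω = Ω * M) (hGΩ : G * Ω = Ω * G)
    (hG'Ω : G' * Ω = Ω * G') : (G' * M * G) * Ω = Ω * (G' * M * G) := by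
  calc G' * M * G * Ω = G' * M * (G * Ω) := by simp only [mul_assoc]
    _ = G' * M * (Ω * G) := by rw [hGΩ]
    _ = G' * (M * Ω) * G := by simp only [mul_assoc]
    _ = G' * (Ω * M) * G := by rw [hMΩ]
    _ = (G' * Ω) * M * G := by simp only [mul_assoc]
    _ = (Ω * G') * M * G := by rw [hG'Ω]
    _ = Ω * (G' * M * G) := by simp only [mul_assoc]

/-- If the conjugates `G′ M G`, `G′ N G` commute, so do `M` and `N`. -/
theorem mul_comm_of_conj_mul_comm {G G' M N : S} (hGG' : G * G' = 1) (hG'G : G' * G = 1)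
    (h : (G' * M * G) * (G' * N * G) = (G' * N * G) * (G' * M * G)) : M * N = N * M := by
  have hM : M = G * (G' * M * G) * G' := by
    calc M = (G * G') * M * (G * G') := by rw [hGG', one_mul, mul_one]
      _ = G * (G' * M * G) * G' := by simp only [mul_assoc]
  have hN : N = G * (G' * N * G) * G' := by
    calc N = (G * G') * N * (G * G') := by rw [hGG', one_mul, mul_one]
      _ = G * (G' * N * G) * G' := by simp only [mul_assoc]
  calc M * N = (G * (G' * M * G) * G') * (G * (G' * N * G) * G') := by rw [← hM, ← hN]
    _ = G * ((G' * M * G) * (G' * G) * (G' * N * G)) * G' := by simp only [mul_assoc]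
    _ = G * ((G' * M * G) * (G' * N * G)) * G' := by rw [hG'G, mul_one]
    _ = G * ((G' * N * G) * (G' * M * G)) * G' := by rw [h]
    _ = G * ((G' * N * G) * (G' * G) * (G' * M * G)) * G' := by rw [hG'G, mul_one]
    _ = (G * (G' * N * G) * G') * (G * (G' * M * G) * G') := by simp only [mul_assoc]
    _ = N * M := by rw [← hM, ← hN]

end ConjugationAlgebra

section Planes

variable {k : Type} [Field k] [NumberField k]

/-- Membership in a commutant, unfolded. -/
theorem mem_commutant_iff (W : PlaneData k) (A : Matrix (Fin 4) (Fin 4) k) (x : GA W) :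
    x ∈ commutant W A ↔ GA.mat W x * adMat k A = adMat k A * GA.mat W x := Iff.rfl

/-- Elements of the unitary group commute with `Ω`. -/
theorem mat_mul_adMat_Ω (W : PlaneData k) (x : GA W) : GA.mat W x * adMat k W.Ω = adMat k W.Ω * GA.mat W x :=
  ((mem_unitaryGroup W _).1 x.2).1

/-- **`T` of a plane with the row shapes is abelian**: for `x, y ∈ torusT W`, `x y = y x`, whenever the adelic
`P₀` is `blockDiag4R 1 0` and the adelic `Ω` is `blockDiag4R ω ω`. -/
theorem mul_comm_of_mem_torusT_of_shapes (W : PlaneData k) (t n : Ad k)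
    (hP0 : adMat k (W.P 0) = blockDiag4R (1 : Matrix (Fin 2) (Fin 2) (Ad k)) 0)
    (hΩ : adMat k W.Ω = blockDiag4R (omegaMatR t n) (omegaMatR t n))
    (x y : GA W) (hx : x ∈ torusT W) (hy : y ∈ torusT W) : x * y = y * x := by
  have hxP := (mem_commutant_iff W _ x).1 hx.1
  have hyP := (mem_commutant_iff W _ y).1 hy.1
  have hxΩ := mat_mul_adMat_Ω W x
  have hyΩ := mat_mul_adMat_Ω W y
  rw [hP0] at hxP hyP
  rw [hΩ] at hxΩ hyΩ
  have hmat : GA.mat W (x * y) = GA.mat W (y * x) := by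
    rw [GA.mat_mul, GA.mat_mul]
    exact mul_comm_of_commute_shapes t n hxP hxΩ hyP hyΩ
  exact Subtype.ext (Units.ext hmat)

/-- **The transported `T′` of a plane with the row shapes is abelian**: for `x, y ∈ torusT' (W.withTransportedTorus g
g' …)`, `x y = y x`. -/
theorem mul_comm_of_mem_torusT'_of_shapes (W : PlaneData k) (t n : Ad k)
    (hP0 : adMat k (W.P 0) = blockDiag4R (1 : Matrix (Fin 2) (Fin 2) (Ad k)) 0)
    (hΩ : adMat k W.Ω = blockDiag4R (omegaMatR t n) (omegaMatR t n))
    (g g' : Matrix (Fin 4) (Fin 4) k) (hgg' : g * g' = 1) (hg'g : g' * g = 1) (hgΩ : g * W.Ω = W.Ω * g)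
    (x y : GA (W.withTransportedTorus g g' hgg' hg'g hgΩ))
    (hx : x ∈ torusT' (W.withTransportedTorus g g' hgg' hg'g hgΩ))
    (hy : y ∈ torusT' (W.withTransportedTorus g g' hgg' hg'g hgΩ)) : x * y = y * x := by
  have hGG' : adMat k g * adMat k g' = 1 := by rw [← adMat_mul, hgg', adMat_one]
  have hG'G : adMat k g' * adMat k g = 1 := by rw [← adMat_mul, hg'g, adMat_one]
  have hgΩ' : adMat k g * adMat k W.Ω = adMat k W.Ω * adMat k g := by rw [← adMat_mul, hgΩ, adMat_mul]
  have hg'Ω : adMat k g' * adMat k W.Ω = adMat k W.Ω * adMat k g' := inv_commute_of_commute hGG' hG'G hgΩ'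
  have hQ0 : adMat k ((W.withTransportedTorus g g' hgg' hg'g hgΩ).Q 0) = adMat k g * adMat k (W.P 0) * adMat k g' := by
    rw [withTransportedTorus_Q, adMat_mul, adMat_mul]
  -- the conjugates `g′ x g`, `g′ y g` commute with `P₀` and `Ω`
  have hxQ := (mem_commutant_iff _ _ x).1 hx.1
  have hyQ := (mem_commutant_iff _ _ y).1 hy.1
  rw [hQ0] at hxQ hyQ
  have hxP := conj_commute_of_commute_conj hG'G hxQ
  have hyP := conj_commute_of_commute_conj hG'G hyQ
  have hxΩ : (adMat k g' * GA.mat _ x * adMat k g) * adMat k W.Ω =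
      adMat k W.Ω * (adMat k g' * GA.mat _ x * adMat k g) :=
    conj_commute_of_commute (mat_mul_adMat_Ω _ x) hgΩ' hg'Ω
  have hyΩ : (adMat k g' * GA.mat _ y * adMat k g) * adMat k W.Ω =
      adMat k W.Ω * (adMat k g' * GA.mat _ y * adMat k g) :=
    conj_commute_of_commute (mat_mul_adMat_Ω _ y) hgΩ' hg'Ω
  rw [hP0] at hxP hyP
  rw [hΩ] at hxΩ hyΩ
  have hmat : GA.mat _ (x * y) = GA.mat _ (y * x) := by
    rw [GA.mat_mul, GA.mat_mul]
    exact mul_comm_of_conj_mul_comm hGG' hG'G (mul_comm_of_commute_shapes t n hxP hxΩ hyP hyΩ)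
  exact Subtype.ext (Units.ext hmat)

end Planes

section RowPlane

variable {k : Type} [Field k] [NumberField k] (q : QuadData k) (a b ε : k)

/-- The adelic `Ω` of the row plane is `blockDiag4R ω_𝔸 ω_𝔸`. -/
theorem adMat_Ω_ofLinesRow :
    adMat k (PlaneData.ofLinesRow q a b ε).Ω =
      blockDiag4R (omegaMatR (algebraMap k (Ad k) q.t) (algebraMap k (Ad k) q.n))
        (omegaMatR (algebraMap k (Ad k) q.t) (algebraMap k (Ad k) q.n)) := by
  show adMat k (blockDiag4 (omegaMat q) (omegaMat q)) = _
  rw [adMat_blockDiag4, omegaMat_map]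

/-- The adelic first projector of the row plane is `blockDiag4R 1 0`. -/
theorem adMat_P0_ofLinesRow :
    adMat k ((PlaneData.ofLinesRow q a b ε).P 0) = blockDiag4R (1 : Matrix (Fin 2) (Fin 2) (Ad k)) 0 := by
  show adMat k (blockDiag4 1 0) = _
  exact adMat_blockDiag4_one_zero

/-- **The torus `T(𝔸)` of a row plane is abelian.** -/
theorem mul_comm_of_mem_torusT (x y : GA (PlaneData.ofLinesRow q a b ε))
    (hx : x ∈ torusT (PlaneData.ofLinesRow q a b ε)) (hy : y ∈ torusT (PlaneData.ofLinesRow q a b ε)) :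
    x * y = y * x :=
  mul_comm_of_mem_torusT_of_shapes _ _ _ (adMat_P0_ofLinesRow q a b ε) (adMat_Ω_ofLinesRow q a b ε) x y hx hy

/-- The torus `T(𝔸)` of a row plane is abelian, on the subtype. -/
theorem torusT_mul_comm (s t : torusT (PlaneData.ofLinesRow q a b ε)) : s * t = t * s :=
  Subtype.ext (mul_comm_of_mem_torusT q a b ε s t s.2 t.2)

variable (g g' : Matrix (Fin 4) (Fin 4) k) (hgg' : g * g' = 1) (hg'g : g' * g = 1)
  (hgΩ : g * (PlaneData.ofLinesRow q a b ε).Ω = (PlaneData.ofLinesRow q a b ε).Ω * g)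

/-- **The transported torus `T′(𝔸)` of a row plane is abelian.** -/
theorem mul_comm_of_mem_torusT'
    (x y : GA ((PlaneData.ofLinesRow q a b ε).withTransportedTorus g g' hgg' hg'g hgΩ))
    (hx : x ∈ torusT' ((PlaneData.ofLinesRow q a b ε).withTransportedTorus g g' hgg' hg'g hgΩ))
    (hy : y ∈ torusT' ((PlaneData.ofLinesRow q a b ε).withTransportedTorus g g' hgg' hg'g hgΩ)) :
    x * y = y * x :=
  mul_comm_of_mem_torusT'_of_shapes _ _ _ (adMat_P0_ofLinesRow q a b ε) (adMat_Ω_ofLinesRow q a b ε) g g' hgg' hg'g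
    hgΩ x y hx hy

/-- **`hcomm` for the seesaw plane of the wall**: the transported torus `T′(𝔸)` of
`(ofLinesRow q a b ε).withTransportedTorus g g' …` is abelian, in the shape the `_of_isHaar` theorems of
`Line4/ThetaEquivariance.lean` take (`seesawPlane q a g g' … = (mixedRow q (a 0) (a 2)).withTransportedTorus g g' …`,
`mixedRow q a b = ofLinesRow q a b (-1)`). -/
theorem torusT'_mul_comm
    (s t : torusT' ((PlaneData.ofLinesRow q a b ε).withTransportedTorus g g' hgg' hg'g hgΩ)) : s * t = t * s :=
  Subtype.ext (mul_comm_of_mem_torusT' q a b ε g g' hgg' hg'g hgΩ s t s.2 t.2)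

end RowPlane

end Summit.Ventures.HodgeRepro.Tier4.Line4

end
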